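import Literature.NumberTheory.EllipticCurves.BinaryQuarticOrbitWeightsIntegralProofs
import Literature.NumberTheory.EllipticCurves.BinaryQuarticMinimisationProofs
import Literature.NumberTheory.EllipticCurves.BinaryQuarticReductionProofs
import HarnessLib

/-!
# For a curve without rational `2`-torsion, the `PGL₂(ℚ)`-classes of locally soluble quartics with
# its invariants are counted exactly by the weights `1/m`

`Proofs` companion (theorems only: no definitions, no named facts) of `BinaryQuarticOrbitWeights.lean`,
`BhargavaShankarWeightProduct.lean` and `BinaryQuarticOrbitWeightsIntegralProofs.lean`. Source:
M. Bhargava, A. Shankar, *Binary quartic forms having bounded invariants, and the boundedness of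
the average rank of elliptic curves*, Ann. of Math. (2) 181 (2015) 191–242, §3.2 of the published
version (= `arXiv:1006.1002v3`): "in order to use this correspondence to count `2`-Selmer elements
… we must count `PGL₂(ℤ)`-orbits on `V_ℤ` where each orbit `PGL₂(ℤ)·f` is weighted by `1/n(f)` … it
suffices to instead weight each integral orbit `PGL₂(ℤ)·f` by `1/m(f)`", the two weightings
differing only on the orbits with a nontrivial stabilizer in `PGL₂(ℚ)`; and by Thm 3.2 (tree:
`BinaryQuartic.pgl2StabilizerCard_eq`, Lemma 5.11 of the held arXiv text) a nontrivial stabilizer of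
a form with the invariants `(2⁴·(−3A), 2⁶·(−27B))` of `E_{A,B}` means a rational `2`-torsion point
on `E_{A,B}`. This file proves the resulting exact statement, curve by curve:

**Theorem** (`pgl2QClassCount_selmerSet_eq_sum_one_div_globalWeight`). Let `A, B ∈ ℤ` with
`x³ + Ax + B` irreducible over `ℚ` in the weak sense `∀ r ∈ ℚ, r³ + Ar + B ≠ 0` (no rational
`2`-torsion; this forces `4A³ + 27B² ≠ 0`). Let `S = S_{A,B}` be the set of locally soluble,
irreducible `f ∈ V_ℤ` with `I(f) = 2⁴·(−3A)`, `J(f) = 2⁶·(−27B)` (the summand of the tree's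
`locSolIrredClassCount`/`N(S^F; ·)` at `(A, B)`). Then `S` meets finitely many `GL₂(ℤ)`-orbits `O`,
and for any representatives `f_O ∈ O`,

  `#{PGL₂(ℚ)-classes met by S} = Σ_O 1/m(f_O) = Σ_O ∏_p 1/m_p(f_O)`.

Ingredients: `S` is closed under `PGL₂(ℚ)`-equivalence (`mem_selmerSet_of_pgl2Equiv`: invariants,
local solubility (`KEquiv.isLocallySoluble_iff`) and, in the absence of rational `2`-torsion,
irreducibility (`PGL2Equiv.isIrreducible_iff`) are class invariants); every `f ∈ S` has `Δ(f) ≠ 0`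
and trivial stabilizer in `PGL₂(ℚ)` (`stabilizer_le_center_of_mem_selmerSet`), so
`sum_one_div_globalWeight_eq_pgl2QClassCount_of_stabilizer_le` applies; finiteness is the tree's
reduction theory (`BinaryQuartic.finite_gl2zOrbits`); and `m = ∏_p m_p` is Prop. 3.6
(`globalWeight_eq_finprod_localWeightAt`).

## References

* M. Bhargava, A. Shankar, Ann. of Math. (2) 181 (2015) 191–242, §3.2 and Prop. 3.6 of the published
  version; Lemma 5.11 / Thm 5.6 of arXiv:1006.1002v2. [cite: BhargavaShankarAnnals2015, §3.2 (1/m versus 1/n; published numbering)]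
-/

noncomputable section

open scoped Classical
open Matrix MulAction Literature.GroupTheory.Index

namespace Literature.NumberTheory.EllipticCurves

namespace BinaryQuartic

variable {A B : ℤ}

/-- A form with the invariants `I = 2⁴(−3A)`, `J = 2⁶(−27B)` of `E_{A,B}` has
`Δ(f) = −2¹² (4A³ + 27B²)` (`27Δ = 4I³ − J²`). [folklore] -/
theorem disc_eq_of_invariants {f : BinaryQuartic ℤ} (hI : f.I = 2 ^ 4 * (-3 * A)) (hJ : f.J = 2 ^ 6 * (-27 * B)) :
    f.disc = -(2 ^ 12 * (4 * A ^ 3 + 27 * B ^ 2)) := by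
  have h := twentySeven_mul_disc f
  rw [hI, hJ] at h
  have h27 : (27 : ℤ) ≠ 0 := by norm_num
  apply mul_left_cancel₀ h27
  linear_combination h

/-- Hence `Δ(f) ≠ 0` for such a form as soon as `4A³ + 27B² ≠ 0` (cf. the tree's
`disc_ne_zero_of_invariants`, stated for `(A, B)` in the height family). [folklore] -/
theorem disc_ne_zero_of_I_J_eq (hΔ : 4 * A ^ 3 + 27 * B ^ 2 ≠ 0) {f : BinaryQuartic ℤ}
    (hI : f.I = 2 ^ 4 * (-3 * A)) (hJ : f.J = 2 ^ 6 * (-27 * B)) : f.disc ≠ 0 := by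
  rw [disc_eq_of_invariants hI hJ]
  exact neg_ne_zero.mpr (mul_ne_zero (by norm_num) hΔ)

/-- **`S_{A,B}` is closed under `PGL₂(ℚ)`-equivalence** (no rational `2`-torsion).
[cite: BhargavaShankarAnnals2015, §3.2 (published numbering)] -/
theorem mem_selmerSet_of_pgl2Equiv (hT : ∀ r : ℚ, r ^ 3 + A * r + B ≠ 0) {f g : BinaryQuartic ℤ}
    (hf : f.IsLocallySoluble ∧ f.IsIrreducible ∧ f.I = 2 ^ 4 * (-3 * A) ∧ f.J = 2 ^ 6 * (-27 * B))
    (h : PGL2Equiv (f.map (Int.castRingHom ℚ)) (g.map (Int.castRingHom ℚ))) :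
    g.IsLocallySoluble ∧ g.IsIrreducible ∧ g.I = 2 ^ 4 * (-3 * A) ∧ g.J = 2 ^ 6 * (-27 * B) := by
  obtain ⟨hsol, hirr, hI, hJ⟩ := hf
  have hgI : g.I = 2 ^ 4 * (-3 * A) := by
    have := h.I_eq
    rw [I_map, I_map, eq_intCast, eq_intCast, Int.cast_inj] at this
    rw [this, hI]
  have hgJ : g.J = 2 ^ 6 * (-27 * B) := by
    have := h.J_eq
    rw [J_map, J_map, eq_intCast, eq_intCast, Int.cast_inj] at this
    rw [this, hJ]
  exact ⟨(KEquiv.isLocallySoluble_iff h.kEquiv).mpr hsol,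
    (PGL2Equiv.isIrreducible_iff hT hI hJ hgI hgJ h).mp hirr, hgI, hgJ⟩

/-- **Forms in `S_{A,B}` have only scalar automorphisms in `GL₂(ℚ)`** (no rational `2`-torsion):
the cubic resolvent `φ³ − 3Iφ + J = φ³ + 144Aφ − 1728B` has the rational root `φ` iff
`r = −φ/12` is a root of `r³ + Ar + B`; so `#Stab_{PGL₂(ℚ)}(f) = 1` by Lemma 5.11.
[cite: BhargavaShankarAnnals2015, Lemma 5.11 (arXiv:1006.1002v2 numbering) and §3.2 (published numbering)] -/
theorem stabilizer_le_center_of_invariants (hT : ∀ r : ℚ, r ^ 3 + A * r + B ≠ 0)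
    (hΔ : 4 * A ^ 3 + 27 * B ^ 2 ≠ 0) {f : BinaryQuartic ℤ}
    (hI : f.I = 2 ^ 4 * (-3 * A)) (hJ : f.J = 2 ^ 6 * (-27 * B)) :
    stabilizer (GL (Fin 2) ℚ) (f.map (Int.castRingHom ℚ)) ≤ Subgroup.center (GL (Fin 2) ℚ) := by
  set F := f.map (Int.castRingHom ℚ) with hF
  have hΔF : F.disc ≠ 0 := by
    rw [hF, disc_map, eq_intCast, Int.cast_ne_zero]
    exact disc_ne_zero_of_I_J_eq hΔ hI hJ
  have hroots : resolventRoots F = ∅ := by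
    ext φ
    simp only [resolventRoots, Set.mem_setOf_eq, Set.mem_empty_iff_false, iff_false]
    intro hφ
    rw [hF, I_map, J_map, hI, hJ, eq_intCast, eq_intCast] at hφ
    push_cast at hφ
    apply hT (-φ / 12)
    linear_combination (-1 / 1728 : ℚ) * hφ
  have hcard : pgl2StabilizerCard F = 1 := by
    rw [pgl2StabilizerCard_eq (by norm_num) (by norm_num) hΔF, hroots, Set.ncard_empty]
  rw [← relIndex_center_stabilizer] at hcard
  exact Subgroup.relIndex_eq_one.mp hcard

/-- `S_{A,B}` meets finitely many `GL₂(ℤ)`-orbits (reduction theory: fixed invariants mean bounded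
height). [cite: BhargavaShankarAnnals2015, Thm 2.1 (finiteness of h(I,J))] -/
theorem finite_gl2zOrbit_image_selmerSet (hΔ : 4 * A ^ 3 + 27 * B ^ 2 ≠ 0) :
    (gl2zOrbit '' {f : BinaryQuartic ℤ | f.IsLocallySoluble ∧ f.IsIrreducible ∧
      f.I = 2 ^ 4 * (-3 * A) ∧ f.J = 2 ^ 6 * (-27 * B)}).Finite := by
  refine (finite_gl2zOrbits (heightIJ (2 ^ 4 * (-3 * A)) (2 ^ 6 * (-27 * B)) + 1)).subset
    (Set.image_mono fun f hf ↦ ?_)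
  obtain ⟨-, hirr, hI, hJ⟩ := hf
  refine ⟨Or.inl (disc_ne_zero_of_I_J_eq hΔ hI hJ), hirr, ?_⟩
  rw [height, hI, hJ]
  exact lt_add_one _

/-- **The exact count, curve by curve.** For `(A, B)` without rational `2`-torsion (and
`4A³ + 27B² ≠ 0`) and any representatives `f_O ∈ O` of the `GL₂(ℤ)`-orbits `O` met by `S_{A,B}`:
`Σ_O 1/m(f_O) = #{PGL₂(ℚ)-classes met by S_{A,B}}`.
[cite: BhargavaShankarAnnals2015, §3.2 (1/m versus 1/n; published numbering)] -/
theorem pgl2QClassCount_selmerSet_eq_sum_one_div_globalWeight (hT : ∀ r : ℚ, r ^ 3 + A * r + B ≠ 0)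
    (hΔ : 4 * A ^ 3 + 27 * B ^ 2 ≠ 0) {r : Set (BinaryQuartic ℤ) → BinaryQuartic ℤ}
    (hr : ∀ O ∈ gl2zOrbit '' {f : BinaryQuartic ℤ | f.IsLocallySoluble ∧ f.IsIrreducible ∧
      f.I = 2 ^ 4 * (-3 * A) ∧ f.J = 2 ^ 6 * (-27 * B)}, r O ∈ O) :
    ∑ O ∈ (finite_gl2zOrbit_image_selmerSet hΔ).toFinset, (1 : ℚ) / globalWeight (r O) =
      pgl2QClassCount {f : BinaryQuartic ℤ | f.IsLocallySoluble ∧ f.IsIrreducible ∧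
        f.I = 2 ^ 4 * (-3 * A) ∧ f.J = 2 ^ 6 * (-27 * B)} :=
  sum_one_div_globalWeight_eq_pgl2QClassCount_of_stabilizer_le _
    (fun _ hf _ h ↦ mem_selmerSet_of_pgl2Equiv hT hf h)
    (fun _ hf ↦ disc_ne_zero_of_I_J_eq hΔ hf.2.2.1 hf.2.2.2)
    (finite_gl2zOrbit_image_selmerSet hΔ)
    (fun _ hf ↦ (stabilizer_le_center_of_invariants hT hΔ hf.2.2.1 hf.2.2.2).trans
      (center_le_integralUpToScalars _))
    hr

/-- `1/m(f) = ∏_p 1/m_p(f)` (Prop. 3.6, as rationals; `Δ(f) ≠ 0`). [cite: BhargavaShankarAnnals2015, Prop. 3.6 (published numbering)] -/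
theorem one_div_globalWeight_eq_finprod (f : BinaryQuartic ℤ) (hΔ : f.disc ≠ 0) :
    (1 : ℚ) / globalWeight f = ∏ᶠ p, (1 : ℚ) / localWeightAt p f := by
  rw [globalWeight_eq_finprod_localWeightAt f hΔ, Nat.cast_finprod']
  simp only [one_div]
  exact (finprod_inv_distrib _).symm

/-- **The count by local weights**: `#{PGL₂(ℚ)-classes met by S_{A,B}} = Σ_O ∏_p 1/m_p(f_O)`
(no rational `2`-torsion). [cite: BhargavaShankarAnnals2015, §3.2 and Prop. 3.6 (published numbering)] -/
theorem pgl2QClassCount_selmerSet_eq_sum_finprod (hT : ∀ r : ℚ, r ^ 3 + A * r + B ≠ 0)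
    (hΔ : 4 * A ^ 3 + 27 * B ^ 2 ≠ 0) {r : Set (BinaryQuartic ℤ) → BinaryQuartic ℤ}
    (hr : ∀ O ∈ gl2zOrbit '' {f : BinaryQuartic ℤ | f.IsLocallySoluble ∧ f.IsIrreducible ∧
      f.I = 2 ^ 4 * (-3 * A) ∧ f.J = 2 ^ 6 * (-27 * B)}, r O ∈ O) :
    (pgl2QClassCount {f : BinaryQuartic ℤ | f.IsLocallySoluble ∧ f.IsIrreducible ∧
        f.I = 2 ^ 4 * (-3 * A) ∧ f.J = 2 ^ 6 * (-27 * B)} : ℚ) =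
      ∑ O ∈ (finite_gl2zOrbit_image_selmerSet hΔ).toFinset, ∏ᶠ p, (1 : ℚ) / localWeightAt p (r O) := by
  rw [← pgl2QClassCount_selmerSet_eq_sum_one_div_globalWeight hT hΔ hr]
  refine Finset.sum_congr rfl fun O hO ↦ ?_
  rw [Set.Finite.mem_toFinset] at hO
  obtain ⟨f₀, hf₀, rfl⟩ := id hO
  have hrO := hr _ hO
  obtain ⟨γ, hγ, hrγ⟩ := hrO
  apply one_div_globalWeight_eq_finprod
  rw [hrγ, GL2ZEquiv.disc_eq ⟨γ, hγ, rfl⟩]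
  exact disc_ne_zero_of_I_J_eq hΔ hf₀.2.2.1 hf₀.2.2.2

end BinaryQuartic

end Literature.NumberTheory.EllipticCurves

end
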